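import Literature.Claims.NS.ClayR3BlowupAlternative
import Literature.Analysis.FluidPDE.ClassicalNSL3Continuation
import Literature.Analysis.FluidPDE.NSLerayHopfSereginProofs
import HarnessLib

/-!
# Clay (A)/(C) reference — the Ladyzhenskaya–Prodi–Serrin `L^q_tL^r_x` criterion in Clay form:
# (A) ⇔ an a priori Serrin-class bound in the finite-energy classical class; Serrin blow-up
# certificates ⇒ (C)

Companion to `ClayR3BlowupAlternative.lean` ((A) ⇔ an a priori `L^∞` bound), `ClayR3L3Bridge.lean`
((A) ⇔ an a priori `L^∞_tL³_x` bound, Escauriaza–Seregin–Šverák), `ClayR3EnstrophyBridge.lean` and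
`ClayR3BKMBridge.lean`. With the tree's Ladyzhenskaya–Prodi–Serrin theorem in the finite-energy classical
class (`Literature.Analysis.FluidPDE.IsClassicalNSSolutionOn.exists_supBound_of_memLqLp`: a
finite-energy classical solution on `[0, T) × ℝ³` from a datum of class (4) lying in
`L^q(0,T; L^r(ℝ³))`, `3 < r ≤ ∞`, `2/q + 3/r ≤ 1`, is BOUNDED on `[0, T) × ℝ³`; Serrin 1962 /
Robinson–Rodrigo–Sadowski Thm. 8.17 via the tree theorem `ladyzhenskaya_prodi_serrin_holds`, the
Leray–Hopf structure supplied by Leray's weak solution) every Serrin class joins the list of a priori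
controls that ARE Fefferman's (A):

* `clayR3_regularityAt_iff_aprioriSerrinBound` / `clayR3_regularity_iff_aprioriSerrinBound(_at)` —
  **(A) ⇔ the a priori `L^q_tL^r_x` bound**, for any fixed pair `3 < r ≤ ∞`, `2/q + 3/r ≤ 1`: for
  `μ > 0`, `clayR3.RegularityAt μ` holds iff every classical solution of the unforced system on a
  half-open slab `[0, T) × ℝ³` from a smooth divergence-free datum of class (4), with energy bounded on
  `[0, T)`, lies in `L^q(0,T; L^r)` (`MemLqLp q r u (Ioo 0 T)`). The pair `(q, r) = (2, ∞)` gives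
  «(A) ⇔ an a priori `L²_tL^∞_x` bound», sharpening the `L^∞_{t,x}` form of `ClayR3BlowupAlternative`;
* `memLqLp_of_clayR3_solvable` — (A)-solvability of one Cauchy problem puts every finite-energy
  classical solution from the same datum in every `L^q(0,T; L^r)`, `2 ≤ r ≤ ∞` (it is bounded with
  bounded energy);
* `not_clayR3_solvable_of_serrinBlowupCertificate` / `navierStokesBreakdownR3_of_serrinBlowupCertificate`
  — a finite-energy classical solution from a class-(4) datum which is NOT in `L^q(0,T; L^r)` for some
  `2 ≤ r` excludes (A)-solvability and proves the unforced instance of (C);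
* `not_clayR3_solvable_iff_exists_serrinBlowup` — for a Serrin pair, `(μ, 0, u₀)` is NOT Clay-solvable
  ⇔ some finite-energy classical solution from `u₀` on a half-open slab leaves `L^q(0,T; L^r)`.

Usage on a CARD (§3): a REG claim printed as «every smooth finite-energy solution satisfies the
Prodi–Serrin condition `u ∈ L^q(0,T;L^r)`, `2/q + 3/r ≤ 1`, `r > 3`, on its interval of existence,
hence is global» for class-(4) data IS (A) by `clayR3_regularity_iff_aprioriSerrinBound` — the
Prodi–Serrin regularity step, the Leray–Hopf structure and the continuation prose are supplied by the
tree, no Δ6 delta; what stays a delta: the bound asserted only for GLOBAL solutions, a class without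
the energy clause (7) (Δ5), the endpoint `r = 3` (use `ClayR3L3Bridge`, `L^∞_t` only), `r < 3` or
`2/q + 3/r > 1` (not a regularity class).

## References
* C. L. Fefferman, CMI 2006, (A), (C) with (4)–(7) p. 2. [FeffermanClay2006]
* J. Serrin, Arch. Rational Mech. Anal. 9 (1962) 187–195; in: Nonlinear Problems (1963), Thm. 6.
  [Serrin1962]
* J. C. Robinson, J. L. Rodrigo, W. Sadowski, CUP 2016, Thm. 8.17, Thm. 8.19.
  [RobinsonRodrigoSadowski2016]
* J. Leray, Acta Math. 63 (1934), §33–§34. [Leray1934]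
* T. Tao, Anal. PDE 6 (2013) = arXiv:1108.1165: Conj. 1.3, Lemma 8.1, Cor. 11.1, Cor. 11.4. [Tao2011]

WHAT THIS IS NOT: not a claim about NS regularity or blow-up; not a claim about any author beyond
the typed locator.
-/

open scoped ContDiff ENNReal NNReal Topology

namespace Literature.Claims.NS.ClayVariants

open Set Filter MeasureTheory Function Literature.Analysis Literature.Analysis.FluidPDE

noncomputable section

variable {μ T : ℝ} {u₀ : EuclideanSpace ℝ (Fin 3) → EuclideanSpace ℝ (Fin 3)}
  {u : ℝ → EuclideanSpace ℝ (Fin 3) → EuclideanSpace ℝ (Fin 3)}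
  {p : ℝ → EuclideanSpace ℝ (Fin 3) → ℝ}

/-! ## Bounded fields with bounded energy lie in every `L^q_tL^r_x`, `2 ≤ r` -/

/-- **`L^∞ ∩ L² ⊂ L^r` uniformly on a slab**: if `‖u(t, x)‖ ≤ M` and `∫ ‖u(t)‖² ≤ A < ∞` for
`t ∈ [0, T)`, with a.e.-strongly measurable slices, then `u ∈ L^q(0,T; L^r)` for every `q` and every
`2 ≤ r ≤ ∞` (`∫ ‖u‖^r ≤ M^{r-2} ∫ ‖u‖²` slice-wise, and `(0, T)` has finite measure). Private helper.
[folklore] -/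
private theorem memLqLp_of_bounds {q r : ℝ≥0∞} (hr2 : 2 ≤ r) {M : ℝ} {A : ℝ≥0∞} (hA : A < ⊤)
    (hmeas : ∀ t ∈ Ico 0 T, AEStronglyMeasurable (u t) volume)
    (hM : ∀ t ∈ Ico 0 T, ∀ x, ‖u t x‖ ≤ M) (hE : ∀ t ∈ Ico 0 T, ∫⁻ x, ‖u t x‖ₑ ^ 2 ≤ A) :
    MemLqLp q r u (Ioo 0 T) := by
  have hvol : volume (Ioo 0 T) ≠ (⊤ : ℝ≥0∞) := by rw [Real.volume_Ioo]; exact ENNReal.ofReal_ne_top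
  have hptw : ∀ t ∈ Ico 0 T, ∀ x, ‖u t x‖ₑ ≤ ENNReal.ofReal M := fun t ht x => by
    rw [← ofReal_norm]
    exact ENNReal.ofReal_le_ofReal (hM t ht x)
  by_cases hrtop : r = ⊤
  · -- `r = ∞`
    subst hrtop
    refine memLqLp_of_ae_eLpNorm_le (C := ENNReal.ofReal M) ENNReal.ofReal_ne_top hvol ?_ ?_
    · exact (ae_restrict_iff' measurableSet_Ioo).2 (Eventually.of_forall fun t ht =>
        ⟨hmeas t (Ioo_subset_Ico_self ht),
          (eLpNorm_top_le_of_bound (hM t (Ioo_subset_Ico_self ht))).trans_lt ENNReal.ofReal_lt_top⟩)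
    · exact (ae_restrict_iff' measurableSet_Ioo).2 (Eventually.of_forall fun t ht =>
        eLpNorm_top_le_of_bound (hM t (Ioo_subset_Ico_self ht)))
  · -- `2 ≤ r < ∞`
    have hr0 : r ≠ 0 := by
      intro h
      rw [h] at hr2
      exact absurd hr2 (by norm_num)
    set ρ : ℝ := r.toReal with hρ
    have hρ2 : 2 ≤ ρ := by
      have := ENNReal.toReal_mono hrtop hr2
      simpa [hρ] using this
    have hρ0 : 0 < ρ := by linarith
    -- the slice bound `∫ ‖u(t)‖^ρ ≤ M^{ρ-2} A`
    set K : ℝ≥0∞ := ENNReal.ofReal M ^ (ρ - 2) * A with hK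
    have hKtop : K ≠ ⊤ :=
      ENNReal.mul_ne_top (ENNReal.rpow_ne_top_of_nonneg (by linarith) ENNReal.ofReal_ne_top) hA.ne
    have hslice : ∀ t ∈ Ico 0 T, ∫⁻ x, ‖u t x‖ₑ ^ ρ ≤ K := by
      intro t ht
      have hpt : ∀ x, ‖u t x‖ₑ ^ ρ ≤ ENNReal.ofReal M ^ (ρ - 2) * ‖u t x‖ₑ ^ 2 := fun x => by
        have hsplit : ‖u t x‖ₑ ^ ρ = ‖u t x‖ₑ ^ (ρ - 2) * ‖u t x‖ₑ ^ (2 : ℝ) := by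
          rw [← ENNReal.rpow_add_of_nonneg _ _ (by linarith) (by norm_num)]
          congr 1
          ring
        rw [hsplit, ENNReal.rpow_two]
        gcongr
        exact hptw t ht x
      calc ∫⁻ x, ‖u t x‖ₑ ^ ρ ≤ ∫⁻ x, ENNReal.ofReal M ^ (ρ - 2) * ‖u t x‖ₑ ^ 2 := lintegral_mono hpt
        _ = ENNReal.ofReal M ^ (ρ - 2) * ∫⁻ x, ‖u t x‖ₑ ^ 2 := by
          rw [lintegral_const_mul' _ _ (ENNReal.rpow_ne_top_of_nonneg (by linarith)
            ENNReal.ofReal_ne_top)]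
        _ ≤ K := by rw [hK]; gcongr; exact hE t ht
    have heLp : ∀ t ∈ Ico 0 T, eLpNorm (u t) r volume ≤ K ^ (1 / ρ) := fun t ht => by
      rw [eLpNorm_eq_lintegral_rpow_enorm_toReal hr0 hrtop]
      exact ENNReal.rpow_le_rpow (hslice t ht) (by positivity)
    have hCtop : K ^ (1 / ρ) ≠ ⊤ := ENNReal.rpow_ne_top_of_nonneg (by positivity) hKtop
    refine memLqLp_of_ae_eLpNorm_le (C := K ^ (1 / ρ)) hCtop hvol ?_ ?_
    · exact (ae_restrict_iff' measurableSet_Ioo).2 (Eventually.of_forall fun t ht =>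
        ⟨hmeas t (Ioo_subset_Ico_self ht),
          (heLp t (Ioo_subset_Ico_self ht)).trans_lt (lt_top_iff_ne_top.2 hCtop)⟩)
    · exact (ae_restrict_iff' measurableSet_Ioo).2 (Eventually.of_forall fun t ht =>
        heLp t (Ioo_subset_Ico_self ht))

/-! ## (A)-solvability puts every finite-energy classical solution in the Serrin classes -/

/-- **Clay (A)-solvability ⇒ every finite-energy classical solution from the same datum lies in
`L^q(0,T; L^r)` for every `q` and every `2 ≤ r ≤ ∞`**: the Clay solution equals `u` on `[0, T)` and
is bounded there (`exists_bounds_of_clayR3_solvable`, Tao's Cor. 11.4 + Cor. 11.1), with bounded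
energy. [cite: FeffermanClay2006, (A) with (4) (6) (7) p. 2] [cite: Tao2011, Cor. 11.4 + Cor. 11.1] -/
theorem memLqLp_of_clayR3_solvable (hμ : 0 < μ) (hu₀ : ContDiff ℝ ∞ u₀)
    (hdec : HasRapidSpatialDecay u₀)
    (hcl : IsClassicalNSSolutionOn (Ico 0 T) μ 0 u p) (hu0 : u 0 = u₀)
    (hE : ∃ A : ℝ≥0∞, A < ⊤ ∧ ∀ t ∈ Ico 0 T, ∫⁻ x, ‖u t x‖ₑ ^ 2 ≤ A)
    (hsol : clayR3.Solvable μ 0 u₀) {q r : ℝ≥0∞} (hr2 : 2 ≤ r) :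
    MemLqLp q r u (Ioo 0 T) := by
  obtain ⟨M, hM⟩ := exists_bounds_of_clayR3_solvable hμ (hu₀.of_le (by norm_cast)) hdec hcl hu0
    hE hsol 0
  obtain ⟨A, hA, hb⟩ := hE
  refine memLqLp_of_bounds (M := M) hr2 hA
    (fun t ht => (hcl.contDiff_velocity ht).continuous.aestronglyMeasurable) (fun t ht x => ?_) hb
  simpa using hM t ht x

/-! ## Serrin blow-up certificates exclude (A)-solvability and prove (C) -/

/-- **A SERRIN BLOW-UP CERTIFICATE excludes Clay solvability**: a classical solution of the unforced
system on `[0, T) × ℝ³` from a smooth datum of class (4), with energy bounded on `[0, T)`, which is NOT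
in `L^q(0,T; L^r)` for some `q` and some `2 ≤ r ≤ ∞`, shows that `(μ, 0, u₀)` has no Clay (A)-class
solution. [cite: FeffermanClay2006, (A) (C) with (4)–(7) p. 2] [cite: Serrin1962, Thm. (regularity in L^qL^r)]
[cite: Tao2011, Cor. 11.4 + Cor. 11.1] -/
theorem not_clayR3_solvable_of_serrinBlowupCertificate (hμ : 0 < μ) (hu₀ : ContDiff ℝ ∞ u₀)
    (hdec : HasRapidSpatialDecay u₀)
    (hcl : IsClassicalNSSolutionOn (Ico 0 T) μ 0 u p) (hu0 : u 0 = u₀)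
    (hE : ∃ A : ℝ≥0∞, A < ⊤ ∧ ∀ t ∈ Ico 0 T, ∫⁻ x, ‖u t x‖ₑ ^ 2 ≤ A) {q r : ℝ≥0∞} (hr2 : 2 ≤ r)
    (hblow : ¬ MemLqLp q r u (Ioo 0 T)) :
    ¬ clayR3.Solvable μ 0 u₀ := fun hsol =>
  hblow (memLqLp_of_clayR3_solvable hμ hu₀ hdec hcl hu0 hE hsol hr2)

/-- **A Serrin blow-up certificate proves the unforced instance of (C)** (`NavierStokesBreakdownR3`).
[cite: FeffermanClay2006, (C) with (4)–(7) p. 2] [cite: Serrin1962, Thm. (regularity in L^qL^r)] -/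
theorem navierStokesBreakdownR3_of_serrinBlowupCertificate (hμ : 0 < μ) (hu₀ : ContDiff ℝ ∞ u₀)
    (hdiv : NSWave0.IsDivFree u₀) (hdec : HasRapidSpatialDecay u₀)
    (hcl : IsClassicalNSSolutionOn (Ico 0 T) μ 0 u p) (hu0 : u 0 = u₀)
    (hE : ∃ A : ℝ≥0∞, A < ⊤ ∧ ∀ t ∈ Ico 0 T, ∫⁻ x, ‖u t x‖ₑ ^ 2 ≤ A) {q r : ℝ≥0∞} (hr2 : 2 ≤ r)
    (hblow : ¬ MemLqLp q r u (Ioo 0 T)) :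
    Summit.NavierStokesRegularity.NavierStokesRegularity.NavierStokesBreakdownR3 :=
  navierStokesBreakdownR3_of_not_solvable hμ hu₀ hdiv hdec isSmoothOnHalfSpace_zero
    clayR3_force_zero
    (not_clayR3_solvable_of_serrinBlowupCertificate hμ hu₀ hdec hcl hu0 hE hr2 hblow)

/-! ## (A) ⇔ the a priori Serrin-class bound -/

/-- **Clay (A) at viscosity `μ` ⇔ the a priori `L^q_tL^r_x` bound in the finite-energy classical class**
(Ladyzhenskaya–Prodi–Serrin read with Leray's structure theorem), for one fixed Serrin pair
`3 < r ≤ ∞`, `2/q + 3/r ≤ 1`: `clayR3.RegularityAt μ` holds iff for every smooth divergence-free datum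
of class (4), every `T` and every classical solution `(u, p)` of the unforced system on `[0, T) × ℝ³`
with `u 0 = u₀` and energy bounded on `[0, T)`, `u ∈ L^q(0,T; L^r(ℝ³))`. (⇒):
`memLqLp_of_clayR3_solvable`; (⇐): by the blow-up alternative (`clayR3_solvable_or_supBlowup`) a
non-solvable datum carries a finite-energy classical solution on some `[0, T*)` with UNBOUNDED velocity;
it is in the Serrin class by hypothesis, hence bounded
(`IsClassicalNSSolutionOn.exists_supBound_of_memLqLp`) — contradiction.
[cite: FeffermanClay2006, (A) with (4) (6) (7) p. 2] [cite: Serrin1962, Thm. (regularity in L^qL^r)]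
[cite: RobinsonRodrigoSadowski2016, Thm. 8.17] [cite: Leray1934, §33] [cite: Tao2011, Conj. 1.3, Lemma 8.1, Cor. 11.1, Cor. 11.4] -/
theorem clayR3_regularityAt_iff_aprioriSerrinBound (hμ : 0 < μ) {q r : ℝ≥0∞} (hr : 3 < r)
    (hqr : 2 / q + 3 / r ≤ 1) :
    clayR3.RegularityAt μ ↔
      ∀ (u₀ : EuclideanSpace ℝ (Fin 3) → EuclideanSpace ℝ (Fin 3)), ContDiff ℝ ∞ u₀ →
        NSWave0.IsDivFree u₀ → HasRapidSpatialDecay u₀ →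
        ∀ (T : ℝ) (u : ℝ → EuclideanSpace ℝ (Fin 3) → EuclideanSpace ℝ (Fin 3))
          (p : ℝ → EuclideanSpace ℝ (Fin 3) → ℝ),
          IsClassicalNSSolutionOn (Ico 0 T) μ 0 u p → u 0 = u₀ →
          (∃ A : ℝ≥0∞, A < ⊤ ∧ ∀ t ∈ Ico 0 T, ∫⁻ x, ‖u t x‖ₑ ^ 2 ≤ A) →
            MemLqLp q r u (Ioo 0 T) := by
  have hr2 : 2 ≤ r := le_of_lt (lt_trans (by norm_num) hr)
  constructor
  · intro hreg u₀ hu₀ hdiv hdec T u p hcl hu0 hE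
    exact memLqLp_of_clayR3_solvable hμ hu₀ hdec hcl hu0 hE (hreg u₀ hu₀ hdiv hdec) hr2
  · intro hbd u₀ hu₀ hdiv hdec
    rcases clayR3_solvable_or_supBlowup hμ hu₀ hdiv hdec with
      hsol | ⟨Ts, hTs, u, p, hcl, hu0, hE, hub, -⟩
    · exact hsol
    · exfalso
      have hS := hbd u₀ hu₀ hdiv hdec Ts u p hcl hu0 hE
      have hdec0 : HasRapidSpatialDecay (u 0) := by
        rw [hu0]
        exact hdec
      obtain ⟨M, hM⟩ := hcl.exists_supBound_of_memLqLp hμ hTs hdec0 hE hr hqr hS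
      obtain ⟨t, ht, x, hMx⟩ := hub M
      exact absurd hMx (not_lt.2 (hM t ht x))

/-- **(A) ⇔ the a priori Serrin-class bound at every viscosity.** `clayR3.Regularity` is
token-for-token the summit statement `NavierStokesRegularity`.
[cite: FeffermanClay2006, (A) with (4) (6) (7) p. 2] [cite: Serrin1962, Thm. (regularity in L^qL^r)]
[cite: Tao2011, Conj. 1.3, Cor. 11.1, Cor. 11.4] -/
theorem clayR3_regularity_iff_aprioriSerrinBound {q r : ℝ≥0∞} (hr : 3 < r) (hqr : 2 / q + 3 / r ≤ 1) :
    clayR3.Regularity ↔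
      ∀ μ : ℝ, 0 < μ →
      ∀ (u₀ : EuclideanSpace ℝ (Fin 3) → EuclideanSpace ℝ (Fin 3)), ContDiff ℝ ∞ u₀ →
        NSWave0.IsDivFree u₀ → HasRapidSpatialDecay u₀ →
        ∀ (T : ℝ) (u : ℝ → EuclideanSpace ℝ (Fin 3) → EuclideanSpace ℝ (Fin 3))
          (p : ℝ → EuclideanSpace ℝ (Fin 3) → ℝ),
          IsClassicalNSSolutionOn (Ico 0 T) μ 0 u p → u 0 = u₀ →
          (∃ A : ℝ≥0∞, A < ⊤ ∧ ∀ t ∈ Ico 0 T, ∫⁻ x, ‖u t x‖ₑ ^ 2 ≤ A) →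
            MemLqLp q r u (Ioo 0 T) :=
  ⟨fun h μ hμ => (clayR3_regularityAt_iff_aprioriSerrinBound hμ hr hqr).1 (h μ hμ),
    fun h μ hμ => (clayR3_regularityAt_iff_aprioriSerrinBound hμ hr hqr).2 (h μ hμ)⟩

/-- **(A) ⇔ the a priori Serrin-class bound at ONE viscosity `μ > 0`** (Δ7 scaling,
`clayR3_regularityAt_iff`). [cite: FeffermanClay2006, (A) with (4) (6) (7) p. 2]
[cite: Serrin1962, Thm. (regularity in L^qL^r)] [cite: Tao2011, Conj. 1.3, Cor. 11.1, Cor. 11.4] -/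
theorem clayR3_regularity_iff_aprioriSerrinBound_at (hμ : 0 < μ) {q r : ℝ≥0∞} (hr : 3 < r)
    (hqr : 2 / q + 3 / r ≤ 1) :
    clayR3.Regularity ↔
      ∀ (u₀ : EuclideanSpace ℝ (Fin 3) → EuclideanSpace ℝ (Fin 3)), ContDiff ℝ ∞ u₀ →
        NSWave0.IsDivFree u₀ → HasRapidSpatialDecay u₀ →
        ∀ (T : ℝ) (u : ℝ → EuclideanSpace ℝ (Fin 3) → EuclideanSpace ℝ (Fin 3))
          (p : ℝ → EuclideanSpace ℝ (Fin 3) → ℝ),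
          IsClassicalNSSolutionOn (Ico 0 T) μ 0 u p → u 0 = u₀ →
          (∃ A : ℝ≥0∞, A < ⊤ ∧ ∀ t ∈ Ico 0 T, ∫⁻ x, ‖u t x‖ₑ ^ 2 ≤ A) →
            MemLqLp q r u (Ioo 0 T) := by
  rw [← clayR3_regularityAt_iff hμ]
  exact clayR3_regularityAt_iff_aprioriSerrinBound hμ hr hqr

/-- **«(A) ⇔ an a priori `L²_tL^∞_x` bound»** — the Serrin pair `(q, r) = (2, ∞)`: Clay (A) holds iff
every finite-energy classical solution on a half-open slab from a class-(4) datum has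
`∫₀ᵀ ‖u(t)‖²_{L^∞} dt < ∞` (in the tree's mixed-norm class `MemLqLp 2 ∞`). This sharpens the
`L^∞_{t,x}` form `clayR3_regularity_iff_aprioriBound`. [cite: FeffermanClay2006, (A) with (4) (6) (7) p. 2]
[cite: Serrin1962, Thm. (regularity in L^qL^r)] [cite: RobinsonRodrigoSadowski2016, Thm. 8.17] -/
theorem clayR3_regularity_iff_aprioriL2LinftyBound :
    clayR3.Regularity ↔
      ∀ μ : ℝ, 0 < μ →
      ∀ (u₀ : EuclideanSpace ℝ (Fin 3) → EuclideanSpace ℝ (Fin 3)), ContDiff ℝ ∞ u₀ →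
        NSWave0.IsDivFree u₀ → HasRapidSpatialDecay u₀ →
        ∀ (T : ℝ) (u : ℝ → EuclideanSpace ℝ (Fin 3) → EuclideanSpace ℝ (Fin 3))
          (p : ℝ → EuclideanSpace ℝ (Fin 3) → ℝ),
          IsClassicalNSSolutionOn (Ico 0 T) μ 0 u p → u 0 = u₀ →
          (∃ A : ℝ≥0∞, A < ⊤ ∧ ∀ t ∈ Ico 0 T, ∫⁻ x, ‖u t x‖ₑ ^ 2 ≤ A) →
            MemLqLp 2 ⊤ u (Ioo 0 T) :=
  clayR3_regularity_iff_aprioriSerrinBound (q := 2) (r := ⊤) (by simp)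
    (by simp [ENNReal.div_top, ENNReal.div_self])

/-! ## (A)-solvability FAILS iff a Serrin blow-up certificate exists -/

/-- **For a Serrin pair `3 < r ≤ ∞`, `2/q + 3/r ≤ 1`: `(μ, 0, u₀)` is NOT Clay-solvable ⇔ some
finite-energy classical solution from `u₀` on a half-open slab `[0, T) × ℝ³`, `T > 0`, is NOT in
`L^q(0,T; L^r)`.** (⇒): the sup-blowing-up finite-energy classical solution of the blow-up alternative
cannot lie in the Serrin class (it would be bounded); (⇐): `not_clayR3_solvable_of_serrinBlowupCertificate`.
[cite: FeffermanClay2006, (A) (C) with (4)–(7) p. 2] [cite: Serrin1962, Thm. (regularity in L^qL^r)]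
[cite: Leray1934, §33] -/
theorem not_clayR3_solvable_iff_exists_serrinBlowup (hμ : 0 < μ) (hu₀ : ContDiff ℝ ∞ u₀)
    (hdiv : NSWave0.IsDivFree u₀) (hdec : HasRapidSpatialDecay u₀) {q r : ℝ≥0∞} (hr : 3 < r)
    (hqr : 2 / q + 3 / r ≤ 1) :
    ¬ clayR3.Solvable μ 0 u₀ ↔
      ∃ T : ℝ, 0 < T ∧
        ∃ (u : ℝ → EuclideanSpace ℝ (Fin 3) → EuclideanSpace ℝ (Fin 3))
          (p : ℝ → EuclideanSpace ℝ (Fin 3) → ℝ),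
          IsClassicalNSSolutionOn (Ico 0 T) μ 0 u p ∧ u 0 = u₀ ∧
          (∃ A : ℝ≥0∞, A < ⊤ ∧ ∀ t ∈ Ico 0 T, ∫⁻ x, ‖u t x‖ₑ ^ 2 ≤ A) ∧
          ¬ MemLqLp q r u (Ioo 0 T) := by
  have hr2 : 2 ≤ r := le_of_lt (lt_trans (by norm_num) hr)
  constructor
  · intro hno
    rcases clayR3_solvable_or_supBlowup hμ hu₀ hdiv hdec with
      hsol | ⟨Ts, hTs, u, p, hcl, hu0, hE, hub, -⟩
    · exact absurd hsol hno
    · refine ⟨Ts, hTs, u, p, hcl, hu0, hE, fun hS => ?_⟩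
      have hdec0 : HasRapidSpatialDecay (u 0) := by
        rw [hu0]
        exact hdec
      obtain ⟨M, hM⟩ := hcl.exists_supBound_of_memLqLp hμ hTs hdec0 hE hr hqr hS
      obtain ⟨t, ht, x, hMx⟩ := hub M
      exact absurd hMx (not_lt.2 (hM t ht x))
  · rintro ⟨T, -, u, p, hcl, hu0, hE, hblow⟩
    exact not_clayR3_solvable_of_serrinBlowupCertificate hμ hu₀ hdec hcl hu0 hE hr2 hblow

/-- **`¬(A)` ⇒ a Serrin blow-up certificate exists** for every Serrin pair: if Fefferman's (A) fails,
some `μ > 0` and some datum of class (4) carry a finite-energy classical solution on a half-open slab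
outside `L^q(0,T; L^r)`. [cite: FeffermanClay2006, (A) with (4) (6) (7) p. 2]
[cite: Serrin1962, Thm. (regularity in L^qL^r)] [cite: Leray1934, §33] -/
theorem exists_serrinBlowup_of_not_clayR3_regularity (h : ¬ clayR3.Regularity) {q r : ℝ≥0∞}
    (hr : 3 < r) (hqr : 2 / q + 3 / r ≤ 1) :
    ∃ μ : ℝ, 0 < μ ∧ ∃ u₀ : EuclideanSpace ℝ (Fin 3) → EuclideanSpace ℝ (Fin 3),
      ContDiff ℝ ∞ u₀ ∧ NSWave0.IsDivFree u₀ ∧ HasRapidSpatialDecay u₀ ∧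
      ∃ T : ℝ, 0 < T ∧
        ∃ (u : ℝ → EuclideanSpace ℝ (Fin 3) → EuclideanSpace ℝ (Fin 3))
          (p : ℝ → EuclideanSpace ℝ (Fin 3) → ℝ),
          IsClassicalNSSolutionOn (Ico 0 T) μ 0 u p ∧ u 0 = u₀ ∧
          (∃ A : ℝ≥0∞, A < ⊤ ∧ ∀ t ∈ Ico 0 T, ∫⁻ x, ‖u t x‖ₑ ^ 2 ≤ A) ∧
          ¬ MemLqLp q r u (Ioo 0 T) := by
  unfold ClaySpec.Regularity ClaySpec.RegularityAt at h
  push Not at h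
  obtain ⟨μ, hμ, u₀, hu₀, hdiv, hdec, hno⟩ := h
  exact ⟨μ, hμ, u₀, hu₀, hdiv, hdec,
    (not_clayR3_solvable_iff_exists_serrinBlowup hμ hu₀ hdiv hdec hr hqr).1 hno⟩

end

end Literature.Claims.NS.ClayVariants

-- WHAT THIS IS NOT: not a claim about NS regularity or blow-up; not a claim about any author beyond
-- the typed locator.
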